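import Literature.AnabelianGeometry.AbsoluteAnabelian.AbsTopII.DPSCIndexDataOfEmbeddingCuspCyclic
import Literature.AnabelianGeometry.AbsoluteAnabelian.AbsTopII.InertiaGroupsCuspScopeProofs
import Literature.AnabelianGeometry.AbsoluteAnabelian.AbsTopII.Prop13SmoothCurveModel
import Literature.AnabelianGeometry.AbsoluteAnabelian.FreeProlCyclicEncoding

/-!
# [AbsTopII] Prop 1.3 (i) (`I_e ≅ Ẑ^Σ` for cusps) PROVED at the pro-`l` smooth-curve-shape model

S. Mochizuki, *Topics in Absolute Anabelian Geometry II* [AbsTopII] (bib `MochizukiAbsTopII2013`;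
locators = PDF pages of the kurims manuscript `paper:url-585b8d0ad0d9`), §1 Prop 1.3 (i) p. 11: "If `e` is
a cusp of `𝔾`, then as abstract profinite groups, `I_e ≅ Ẑ^Σ`"; S. Mochizuki, *A combinatorial version of
the Grothendieck conjecture* [CombGC] (`MochizukiCombGC2007`) Rmk 1.1.3 p. 7 (edge-like subgroups `≅ Ẑ^Σ`).

PROOF-ONLY (no definition), abc-iut-L4-t6 lineage (typer of record of `DPSCIndexData.Prop_1_3_i`, FACT-LIST
F-0297, `AbsTopII/InertiaGroups.lean` p405221).  The typed (i) is a predicate on abstract DPSC data; its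
universal closure is refuted (abc-iut-f-069 p427867) and abc-iut-f-069's `prop_1_3_i_ofEmbedding`
(`AbsTopII/DPSCIndexDataOfEmbeddingCuspCyclic.lean`) reduces it at every EMBEDDED datum to the one printed
input "[CombGC] Rmk 1.1.3: the cuspidal subgroups of the PSC datum are free pro-`Σ`-cyclic", kept as a
hypothesis.  Here that input is DISCHARGED for `Σ = {l}` at layer L3's smooth-curve-shape PSC datum over a
pro-`l` completion `ι : Γ_{g,r} → Q` (cusp groups := the closures of `ι(⟨c_j⟩)`):

* `isFreeProSigmaCyclic_cuspGp_of_proL_smoothCurve` — each such cusp group is free pro-`{l}`-cyclic: it is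
  the closure of the cyclic group `⟨ι(c_j)⟩` and INFINITE (L3's `PSCDatum.infinite_cuspGp`, from the
  malnormality theorem `proSigmaCuspInertiaMalnormal_holds`), and in a pro-`l` group a closed subgroup that is
  the closure of a cyclic subgroup is free pro-`{l}`-cyclic iff infinite (this lineage's encoding lemma
  `isFreeProSigmaCyclic_singleton_of_topologicalClosure_zpowers_eq`, `FreeProlCyclicEncoding.lean`);
* `exists_smoothCurve_model_prop_1_3_i` — consequently, at abc-iut-f-066's DPSC-index model WITH CUSPS
  (`exists_smoothCurve_product_model`, p446583: `Π_H = Q × Ẑ^{l}`, `Π_𝔾 = Π_v = Q`, `r ≥ 1` cusps) with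
  `Σ = {l}`, the typed `Prop_1_3_i` HOLDS (and `Prop_1_3_iii''`): FACT-LIST F-0297 is MODEL-WITNESSED at a
  non-toy datum (non-abelian slim `Π_𝔾`, genuine cusp inertia of `Γ_{g,r}`), for every prime `l` and every
  hyperbolic `(g, r)` with `r ≥ 1`;
* `exists_tripodType_model_prop_1_3_i` — the instance `l = 2`, `(g, r) = (0, 3)`.

HONEST FRAMING: `Σ = {l}` only (the general-`Σ` form of "closure of `⟨ι(c)⟩ ≅ Ẑ^Σ`" needs the pro-`Σ`
analogue of the encoding lemma — not in the tree; -- TODO(general form)); constructed ≠ geometric; typed ≠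
proved beyond this model; nothing here bears on [IUTchIII] Cor 3.12.
-/

open scoped Pointwise

universe u

namespace Literature.AnabelianGeometry.AbsoluteAnabelian.AbsTopII

open Literature.AnabelianGeometry.SemiGraphs
open Literature.AnabelianGeometry.SemiGraphs.SemiGraphOfAnabelioids (IsProSigmaCompletion)
open Literature.GroupTheory.CombinatorialGroupTheory

/-- **[CombGC] Rmk 1.1.3 at the pro-`l` smooth-curve-shape datum, PROVED**: for a pro-`{l}` completion
`ι : Γ_{g,r} → Q` of a hyperbolic `Γ_{g,r}` and a PSC datum `G` over `Q` with `Σ = {l}` whose cusp groups are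
the closures of the images `ι(⟨c_j⟩)` of the cusp inertia subgroups, every cusp group is free
pro-`{l}`-cyclic ("`≅ ℤ_l`"): closure of a cyclic subgroup (by construction) and infinite (L3's
`PSCDatum.infinite_cuspGp`), in the pro-`l` group `Q`. [cite: MochizukiCombGC2007, Rmk 1.1.3 p.7] -/
theorem isFreeProSigmaCyclic_cuspGp_of_proL_smoothCurve {l : ℕ} [Fact l.Prime] {g r : ℕ}
    (h : PuncturedSurfaceGroup.IsHyperbolicType g r) {Q : ProfiniteGrp.{u}}
    (ι : PuncturedSurfaceGroup g r →* Q) (hι : IsProSigmaCompletion {l} ι) (G : PSCDatum Q)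
    (hGS : G.Sigma = {l}) (e : G.graph.C ≃ Fin r)
    (hC : ∀ c, G.cuspGp c =
      ((PuncturedSurfaceGroup.cuspInertia (g := g) (e c)).map ι).topologicalClosure)
    (c : G.graph.C) : IsFreeProSigmaCyclic {l} ↥(G.cuspGp c) := by
  have hP : IsProSigma {l} (Q : Type u) := hGS ▸ G.proSigma
  have hinf : (G.cuspGp c : Set Q).Infinite :=
    Set.infinite_coe_iff.mp (PSCDatum.infinite_cuspGp (Set.singleton_nonempty l)
      (fun p hp => by rw [Set.mem_singleton_iff.mp hp]; exact Fact.out) h ι hι G e hC c)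
  have ha : (Subgroup.zpowers (ι (PuncturedSurfaceGroup.c (e c)))).topologicalClosure = G.cuspGp c := by
    rw [hC c, PuncturedSurfaceGroup.cuspInertia, MonoidHom.map_zpowers]
  exact isFreeProSigmaCyclic_singleton_of_topologicalClosure_zpowers_eq hP (G.isClosed_cuspGp c) ha hinf

namespace DPSCIndexData

/-- The typed Prop 1.3 (i) only sees the underlying DPSC data and `Σ`. [cite: MochizukiAbsTopII2013, Prop 1.3 (i) p.11] -/
theorem prop_1_3_i_iff_toDPSCData (X : DPSCIndexData.{u}) :
    X.Prop_1_3_i ↔ ∀ c : X.toDPSCData.Cusp, IsFreeProSigmaCyclic X.Sigma ↥(X.toDPSCData.cuspSub c) :=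
  Iff.rfl

/-- **[AbsTopII] Prop 1.3 (i) AS TYPED (F-0297) HOLDS at the pro-`l` smooth-curve-shape model WITH
CUSPS** (abc-iut-f-066's `exists_smoothCurve_product_model` at `Σ = {l}`): DPSC-index data with `Σ = {l}`,
`r ≥ 1` cusps, no node, `Π_v = Π_𝔾 ≅` a pro-`l` completion of the hyperbolic `Γ_{g,r}`, satisfying
`Prop_1_3_i` ("`I_e ≅ Ẑ^Σ`" for every cusp — the embedded image of a free pro-`{l}`-cyclic cusp group) and
`Prop_1_3_iii''`.  Non-toy model witness for FACT-LIST F-0297. [cite: MochizukiAbsTopII2013, Prop 1.3 (i) p.11] -/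
theorem exists_smoothCurve_model_prop_1_3_i (l : ℕ) [Fact l.Prime] (g r : ℕ)
    (hgr : PuncturedSurfaceGroup.IsHyperbolicType g r) (hr : 0 < r) :
    ∃ X : DPSCIndexData.{0}, X.Sigma = {l} ∧ Nonempty (X.Cusp ≃ Fin r) ∧ IsEmpty X.Node ∧
      (∀ v, X.vertSub v = X.PiG) ∧
      Literature.AnabelianGeometry.AbsoluteAnabelian.AbsTopII.DPSCIndexData.Prop_1_3_i X ∧
      Literature.AnabelianGeometry.AbsoluteAnabelian.AbsTopII.DPSCIndexData.Prop_1_3_iii'' X := by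
  obtain ⟨Q, ι₀, hι₀, Z, hZ, G, hιr, hιn, X, -, -, hGS, -, -, -, -, hcusps, -, -, -, -, hXdef, hXS, -,
    hXc, hXn, -, -, -, hvs, -, -, -, hCTv, hCTc, hslim, hsurj, hcyc, -⟩ :=
    exists_smoothCurve_product_model {l} (Set.singleton_nonempty l)
      (fun p hp => by rw [Set.mem_singleton_iff.mp hp]; exact Fact.out) g r hgr hr
  obtain ⟨e, hC⟩ := hcusps
  -- the cusp groups of the PSC datum are free pro-`{l}`-cyclic
  have hcycG : ∀ c : G.graph.C, IsFreeProSigmaCyclic {l} ↥(G.cuspGp c) := fun c =>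
    isFreeProSigmaCyclic_cuspGp_of_proL_smoothCurve hgr ι₀ (hGS ▸ hι₀) G hGS e hC c
  -- transport along the embedding `inl : Q ↪ Q × Z`
  have hιc : Continuous (MonoidHom.inl Q Z) :=
    (continuous_id.prodMk continuous_const).congr fun x => (MonoidHom.inl_apply x).symm
  have hιi : Function.Injective (MonoidHom.inl Q Z) := fun a b hab => by
    have := congrArg Prod.fst hab
    simpa using this
  have hi : X.Prop_1_3_i := by
    rw [prop_1_3_i_iff_toDPSCData, hXdef, hXS]
    intro c
    obtain ⟨f, -⟩ := exists_subgroupEquiv_ofEmbedding (ProfiniteGrp.of (Q × Z)) (MonoidHom.inl Q Z) hιc hιi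
      (G.isClosed_cuspGp c.down)
    exact (hcycG c.down).of_continuousMulEquiv f
  exact ⟨X, hXS, hXc, hXn, hvs, hi, X.prop_1_3_iii''_of_vertSub_eq_PiG hCTv hCTc hslim hsurj hcyc hvs⟩

/-- The tripod-type instance: `l = 2`, `(g, r) = (0, 3)` — DPSC-index data with three cusps and
`Σ = {2}` at which the typed Prop 1.3 (i) holds. [cite: MochizukiAbsTopII2013, Prop 1.3 (i) p.11] -/
theorem exists_tripodType_model_prop_1_3_i :
    ∃ X : DPSCIndexData.{0}, X.Sigma = {2} ∧ Nonempty (X.Cusp ≃ Fin 3) ∧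
      Literature.AnabelianGeometry.AbsoluteAnabelian.AbsTopII.DPSCIndexData.Prop_1_3_i X := by
  haveI : Fact (Nat.Prime 2) := ⟨Nat.prime_two⟩
  obtain ⟨X, hS, hc, -, -, h, -⟩ := exists_smoothCurve_model_prop_1_3_i 2 0 3
    (by unfold PuncturedSurfaceGroup.IsHyperbolicType; norm_num) (by norm_num)
  exact ⟨X, hS, hc, h⟩

end DPSCIndexData

end Literature.AnabelianGeometry.AbsoluteAnabelian.AbsTopII
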